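import Literature.NumberTheory.LFunctions.MertensSparseCertificate
import Literature.NumberTheory.LFunctions.MertensSparseCertificateData
import HarnessLib

/-!
# Sparse certificate for the disproof of the Mertens conjecture: top edge, count and shape

Compiled evaluations (`native_decide`) of the remaining checkers of `MertensSparseCertificate.lean`
on the data of `MertensSparseCertificateData.lean`: the piece list along `[½, 2] × {812}`
(`checkPieces`, at scale `2¹⁰⁰`, Euler–Maclaurin parameters `N = 320`, `ν = 60`), the
count inequality pinning `N(812) = 500` (`checkCount`, scale `2⁶⁴`), and the shape of the 500
brackets (`checkShape`). A few CPU-seconds. Non-standard axioms: the `native_decide` auxiliary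
axioms only (`computational`).
-/

namespace Literature.NumberTheory.LFunctions.MertensSparseCertificate.ZetaNumerics.SparseCert

open ZetaNumerics.SparseCertData

/-- The piece list along `[½, 2] × {812}` for `ζ` is certified (all labels `0`).
[cite: EdwardsZeta1974, §6.6] -/
theorem checkPieces_top :
    ZetaNumerics.SparseCert.checkPieces (2 ^ 100) ⟨320, 60, 40, 140, 50, 40, 4, 40, 12⟩ 812 1 4096 2048
      ((2080, 0) :: topPiecesTail) = true := by
  native_decide

/-- The count inequality at `T = 812`, `n = 500`, no turns. [cite: EdwardsZeta1974, §6.6] -/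
theorem checkCount_top : ZetaNumerics.SparseCert.checkCount (2 ^ 64) 60 812 1 (ZetaNumerics.SparseCert.turnsNat 0 topPiecesTail) 500 = true := by
  native_decide

/-- The shape conditions of the 500 brackets. [folklore] -/
theorem checkShape_cert :
    ZetaNumerics.SparseCert.checkShape ⟨2 ^ 352, 500, ordinates, 2 ^ 52, 812, 1, yNum, 10 ^ 7⟩ = true := by
  native_decide

/-- The last endpoint of the piece list is `2 = 8192 · 2⁻¹²`. [folklore] -/
theorem lastNat_top : ZetaNumerics.SparseCert.lastNat 2080 topPiecesTail = 2 * 4096 := by decide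

/-- The last label of the piece list is `0`. [folklore] -/
theorem lastDir_top : ZetaNumerics.SparseCert.lastDir 0 topPiecesTail = 0 := by decide

end Literature.NumberTheory.LFunctions.MertensSparseCertificate.ZetaNumerics.SparseCert
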